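import Mathlib.Combinatorics.SimpleGraph.Walk.Counting
import Mathlib.Combinatorics.SimpleGraph.Paths
import Mathlib.Topology.Algebra.InfiniteSum.Constructions
import Mathlib.Topology.Algebra.InfiniteSum.ENNReal
import Summits.CriticalPhenomena.SAWScalingLimit.Theorems.SAWTotalPositivityBoundaryTP2Defs
import HarnessLib

/-!
# Crux `BoundaryTP2` (stmt-CriticalPhenomena-7115), line `corner-deletion-induction`: the single-crossing sector

Let `(A, Aᶜ)` be a vertex cut of a graph `H`, `G_A = SimpleGraph.fromRel (H.Adj a b ∧ a ∈ A ∧ b ∈ A)`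
and `G_B = SimpleGraph.fromRel (H.Adj a b ∧ a ∉ A ∧ b ∉ A)` the parts of `H` inside and outside `A`, and
`Z_G = pathKernel G x` the fugacity-`x` self-avoiding path kernel. The **single-crossing sector** from `a`
to `b` is the set of self-avoiding paths `a → b` of `H` with exactly one dart across the cut (in either
direction), `{γ | #{darts d of γ with (d.fst ∈ A ↔ d.snd ∉ A)} = 1}`.

**Sector decomposition** (`pathKernelOn_singleCrossing_eq`, helper for the registered stub
`singleCrossing_cauchyBinet` of the crux, file `SAWTotalPositivityBoundaryTP2SingleCrossingCB.lean`):
for `a ∈ A`, any `b` and `0 ≤ x`,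

`pathKernelOn H x a b (single-crossing sector) = x · Σ_{(u,v)} Z_A(a,u) · Z_B(v,b)`,

the sum over the cut darts `u → v` of `H` (`u ∈ A`, `v ∉ A`). Proof: a walk from `a ∈ A` with exactly
one crossing dart `u → v` is inside `A` before it and has no crossing after it, so it is
(walk `a → u` of `G_A`) · `uv` · (walk `v → b` of `G_B`), uniquely (the crossing dart is the first exit
from `A`); conversely such a concatenation of self-avoiding pieces is self-avoiding with exactly one
crossing dart and length `|prefix| + |suffix| + 1`. This bijection (`exists_singleCrossing_glue`) is
transported along `Function.Injective.tsum_eq`, then `ENNReal.tsum_sigma'`, `ENNReal.tsum_prod'`,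
`ENNReal.tsum_mul_left/right`. All sums are unconditional sums in `ℝ≥0∞`; no finiteness is needed.
Everything here is proved; Mathlib only (walk surgery adapted from
`SAWTotalPositivityBoundaryTP2TwoEdgeCut.lean` and `SAWTotalPositivityBoundaryTP2OneEdgeCut.lean`).
[folklore]
-/

noncomputable section

namespace Summit.CriticalPhenomena.SAWScalingLimit.Theorems.BoundaryTP2

open scoped ENNReal

variable {V : Type*}

/-! ## Walks on one side of a cut -/

/-- Adjacency in the part of `H` cut out by a vertex predicate `P`
(`SimpleGraph.fromRel fun a b => H.Adj a b ∧ P a ∧ P b`): `u ∼ v` iff `H.Adj u v ∧ P u ∧ P v`. [folklore] -/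
-- adapted from `partGraph_adj` in `SAWTotalPositivityBoundaryTP2OneEdgeCut.lean`
private theorem fromRel_part_adj (H : SimpleGraph V) (P : V → Prop) {u v : V} :
    (SimpleGraph.fromRel fun a b => H.Adj a b ∧ P a ∧ P b).Adj u v ↔ H.Adj u v ∧ P u ∧ P v := by
  rw [SimpleGraph.fromRel_adj]
  constructor
  · rintro ⟨-, h | h⟩
    · exact h
    · exact ⟨h.1.symm, h.2.2, h.2.1⟩
  · exact fun h => ⟨h.1.ne, Or.inl h⟩

/-- If every edge of `G` ends in `P`, a walk of `G` that starts in `P` stays in `P`. [folklore] -/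
-- adapted from `forall_mem_support` in `SAWTotalPositivityBoundaryTP2TwoEdgeCut.lean`
private theorem forall_mem_support_of_start {G : SimpleGraph V} {P : V → Prop}
    (hG : ∀ u v, G.Adj u v → P v) {u v : V} (p : G.Walk u v) (hu : P u) :
    ∀ z ∈ p.support, P z := by
  induction p with
  | nil =>
    intro z hz
    rw [SimpleGraph.Walk.support_nil, List.mem_singleton] at hz
    exact hz ▸ hu
  | cons h q ih =>
    intro z hz
    rw [SimpleGraph.Walk.support_cons, List.mem_cons] at hz
    rcases hz with rfl | hz
    · exact hu
    · exact ih (hG _ _ h) z hz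

/-- The edges of a walk of a subgraph `G ≤ H` are edges of `H`. [folklore] -/
-- adapted from `edges_mem_of_le` in `SAWTotalPositivityBoundaryTP2TwoEdgeCut.lean`
private theorem edges_mem_of_le' {G H : SimpleGraph V} (hle : G ≤ H) {u v : V} (p : G.Walk u v) :
    ∀ e, e ∈ p.edges → e ∈ H.edgeSet :=
  fun _ he => SimpleGraph.edgeSet_mono hle (p.edges_subset_edgeSet he)

/-- A walk of `H` all of whose vertices satisfy `P` is the transfer of a walk of any subgraph `G ≤ H`
containing the `P`-internal edges of `H`. [folklore] -/
-- adapted from `partGraph_lift` in `SAWTotalPositivityBoundaryTP2OneEdgeCut.lean`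
private theorem exists_transfer_eq {H G : SimpleGraph V} {P : V → Prop} (hle : G ≤ H)
    (hG : ∀ u v, H.Adj u v → P u → P v → G.Adj u v) {u v : V} (r : H.Walk u v)
    (hr : ∀ z ∈ r.support, P z) :
    ∃ q : G.Walk u v, q.transfer H (edges_mem_of_le' hle q) = r := by
  induction r with
  | nil => exact ⟨SimpleGraph.Walk.nil, rfl⟩
  | @cons u c _ h r' ih =>
    have hu : P u := hr _ (SimpleGraph.Walk.start_mem_support _)
    have hr' : ∀ z ∈ r'.support, P z := fun z hz =>
      hr z (by rw [SimpleGraph.Walk.support_cons]; exact List.mem_cons_of_mem _ hz)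
    obtain ⟨q', hq'⟩ := ih hr'
    subst hq'
    exact ⟨SimpleGraph.Walk.cons (hG u c h hu (hr' _ (SimpleGraph.Walk.start_mem_support _))) q',
      rfl⟩

/-! ## Counting the darts across the cut -/

open Classical in
/-- Prepending the edge `a c` to a walk adds one crossing dart exactly when `a → c` crosses the cut
`(A, Aᶜ)` (in either direction). [folklore] -/
private theorem countP_darts_cons {H : SimpleGraph V} (A : Set V) {a c b : V} (h : H.Adj a c)
    (w : H.Walk c b) :
    ((SimpleGraph.Walk.cons h w).darts.countP fun d => decide (d.fst ∈ A ↔ d.snd ∉ A)) =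
      (w.darts.countP fun d => decide (d.fst ∈ A ↔ d.snd ∉ A)) +
        if (a ∈ A ↔ c ∉ A) then 1 else 0 := by
  rw [SimpleGraph.Walk.darts_cons, List.countP_cons]
  congr 1
  by_cases hac : (a ∈ A ↔ c ∉ A)
  · rw [if_pos hac, if_pos (decide_eq_true hac)]
  · rw [if_neg hac, if_neg (fun h' => hac (of_decide_eq_true h'))]

open Classical in
/-- A walk without crossing darts stays on the side of the cut it starts on. [folklore] -/
private theorem mem_iff_of_countP_eq_zero {H : SimpleGraph V} (A : Set V) :
    ∀ {u v : V} (w : H.Walk u v),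
      (w.darts.countP fun d => decide (d.fst ∈ A ↔ d.snd ∉ A)) = 0 →
        ∀ z ∈ w.support, (z ∈ A ↔ u ∈ A) := by
  intro u v w
  induction w with
  | nil =>
    intro _ z hz
    rw [SimpleGraph.Walk.support_nil, List.mem_singleton] at hz
    rw [hz]
  | @cons u c _ h w' ih =>
    intro hw z hz
    rw [countP_darts_cons] at hw
    have huc : ¬ (u ∈ A ↔ c ∉ A) := fun huc => by
      rw [if_pos huc] at hw
      exact Nat.succ_ne_zero _ hw
    rw [if_neg huc, Nat.add_zero] at hw
    rw [SimpleGraph.Walk.support_cons, List.mem_cons] at hz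
    rcases hz with rfl | hz
    · exact Iff.rfl
    · exact (ih hw z hz).trans (by tauto)

open Classical in
/-- A walk all of whose vertices lie on one side of the cut has no crossing dart. [folklore] -/
private theorem countP_eq_zero_of_mem_iff {H : SimpleGraph V} (A : Set V) {u v : V} (w : H.Walk u v)
    (hw : ∀ z ∈ w.support, (z ∈ A ↔ u ∈ A)) :
    (w.darts.countP fun d => decide (d.fst ∈ A ↔ d.snd ∉ A)) = 0 := by
  refine List.countP_eq_zero.2 fun d hd => ?_
  have h1 := hw _ (w.dart_fst_mem_support_of_mem_darts hd)
  have h2 := hw _ (w.dart_snd_mem_support_of_mem_darts hd)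
  rw [decide_eq_true_eq]
  tauto

/-! ## Splitting a single-crossing path at its crossing dart -/

open Classical in
/-- **Existence of the splitting.** A walk of `H` from `a ∈ A` with exactly one crossing dart is
`p · uv · q` for a cut dart `u → v` (`u ∈ A`, `v ∉ A`), a walk `p : a → u` of `GA` and a walk
`q : v → b` of `GB`, for any subgraphs `GA, GB ≤ H` containing the edges of `H` inside `A`, resp.
inside `Aᶜ`: before the crossing the walk is in `A`, after it there is no crossing left. [folklore] -/
-- adapted from `exists_split` in `SAWTotalPositivityBoundaryTP2TwoEdgeCut.lean`
private theorem exists_split_of_countP_eq_one {H GA GB : SimpleGraph V} {A : Set V} {b : V}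
    (hAle : GA ≤ H) (hBle : GB ≤ H) (hA : ∀ u v, H.Adj u v → u ∈ A → v ∈ A → GA.Adj u v)
    (hB : ∀ u v, H.Adj u v → u ∉ A → v ∉ A → GB.Adj u v) :
    ∀ {a : V} (w : H.Walk a b), a ∈ A →
      (w.darts.countP fun d => decide (d.fst ∈ A ↔ d.snd ∉ A)) = 1 →
      ∃ (u v : V) (huv : H.Adj u v) (p : GA.Walk a u) (q : GB.Walk v b), u ∈ A ∧ v ∉ A ∧
        w = (p.transfer H (edges_mem_of_le' hAle p)).append
          (SimpleGraph.Walk.cons huv (q.transfer H (edges_mem_of_le' hBle q))) := by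
  intro a w
  induction w with
  | nil =>
    intro _ hw
    rw [SimpleGraph.Walk.darts_nil, List.countP_nil] at hw
    exact absurd hw Nat.zero_ne_one
  | @cons a c _ h w' ih =>
    intro ha hw
    rw [countP_darts_cons] at hw
    by_cases hc : c ∈ A
    · -- the first edge stays inside `A`: prepend it to the splitting of the tail
      rw [if_neg (fun h' => h'.1 ha hc), Nat.add_zero] at hw
      obtain ⟨u, v, huv, p, q, hu, hv, hw'⟩ := ih hc hw
      refine ⟨u, v, huv, SimpleGraph.Walk.cons (hA a c h ha hc) p, q, hu, hv, ?_⟩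
      rw [hw']
      rfl
    · -- the first dart crosses: the tail has no crossing dart left and stays outside `A`
      rw [if_pos ⟨fun _ => hc, fun _ => ha⟩, Nat.add_eq_right] at hw
      have hstay : ∀ z ∈ w'.support, z ∉ A := fun z hz hzA =>
        hc ((mem_iff_of_countP_eq_zero A w' hw z hz).1 hzA)
      obtain ⟨q, hq⟩ := exists_transfer_eq (P := fun z => z ∉ A) hBle hB w' hstay
      subst hq
      exact ⟨a, c, h, SimpleGraph.Walk.nil, q, ha, hc, rfl⟩

/-- **Uniqueness of the splitting.** Two factorisations `p₁ · u₁v₁ · q₁ = p₂ · u₂v₂ · q₂` of one walk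
with `p₁`, `p₂` inside `A` and `v₁, v₂ ∉ A` coincide: the cut dart is the first step out of `A`.
[folklore] -/
-- adapted from `split_unique` in `SAWTotalPositivityBoundaryTP2TwoEdgeCut.lean`
private theorem split_unique' {H : SimpleGraph V} {A : Set V} {b : V} :
    ∀ {a u₁ v₁ u₂ v₂ : V} (p₁ : H.Walk a u₁) (p₂ : H.Walk a u₂) (h₁ : H.Adj u₁ v₁)
      (h₂ : H.Adj u₂ v₂) (q₁ : H.Walk v₁ b) (q₂ : H.Walk v₂ b),
      (∀ z ∈ p₁.support, z ∈ A) → (∀ z ∈ p₂.support, z ∈ A) → v₁ ∉ A → v₂ ∉ A →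
      p₁.append (SimpleGraph.Walk.cons h₁ q₁) = p₂.append (SimpleGraph.Walk.cons h₂ q₂) →
      u₁ = u₂ ∧ v₁ = v₂ ∧ HEq p₁ p₂ ∧ HEq q₁ q₂ := by
  intro a u₁ v₁ u₂ v₂ p₁
  induction p₁ generalizing u₂ with
  | nil =>
    intro p₂ h₁ h₂ q₁ q₂ _ hp₂ hv₁ _ heq
    cases p₂ with
    | nil =>
      simp only [SimpleGraph.Walk.nil_append, SimpleGraph.Walk.cons.injEq] at heq
      obtain ⟨rfl, heq⟩ := heq
      exact ⟨rfl, rfl, HEq.rfl, heq⟩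
    | cons h' r =>
      simp only [SimpleGraph.Walk.nil_append, SimpleGraph.Walk.cons_append,
        SimpleGraph.Walk.cons.injEq] at heq
      obtain ⟨rfl, -⟩ := heq
      exact absurd (hp₂ _ (by simp)) hv₁
  | @cons a c _ h' r ih =>
    intro p₂ h₁ h₂ q₁ q₂ hp₁ hp₂ hv₁ hv₂ heq
    cases p₂ with
    | nil =>
      simp only [SimpleGraph.Walk.nil_append, SimpleGraph.Walk.cons_append,
        SimpleGraph.Walk.cons.injEq] at heq
      obtain ⟨rfl, -⟩ := heq
      exact absurd (hp₁ _ (by simp)) hv₂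
    | cons h'' r' =>
      simp only [SimpleGraph.Walk.cons_append, SimpleGraph.Walk.cons.injEq] at heq
      obtain ⟨rfl, heq⟩ := heq
      obtain ⟨rfl, rfl, h3, h4⟩ := ih r' h₁ h₂ q₁ q₂ (fun z hz => hp₁ z (by simp [hz]))
        (fun z hz => hp₂ z (by simp [hz])) hv₁ hv₂ (eq_of_heq heq)
      refine ⟨rfl, rfl, ?_, h4⟩
      rw [eq_of_heq h3]

open Classical in
/-- **The splitting bijection of the single-crossing sector.** For `a ∈ A`, `b ∉ A` and subgraphs
`GA, GB ≤ H` containing the edges of `H` inside `A`, resp. inside `Aᶜ`, and only edges ending in `A`,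
resp. in `Aᶜ`, gluing `(u → v, p, q) ↦ p · uv · q` is an injection from the triples (cut dart `u → v`,
self-avoiding `p : a → u` in `GA`, self-avoiding `q : v → b` in `GB`) into the self-avoiding paths
`a → b` of `H`, whose range is exactly the single-crossing sector, with `|p · uv · q| = |p| + |q| + 1`.
[folklore] -/
-- adapted from `exists_glue` in `SAWTotalPositivityBoundaryTP2TwoEdgeCut.lean`
private theorem exists_singleCrossing_glue {H GA GB : SimpleGraph V} {A : Set V} {a b : V}
    (ha : a ∈ A) (hAle : GA ≤ H) (hBle : GB ≤ H)
    (hA : ∀ u v, H.Adj u v → u ∈ A → v ∈ A → GA.Adj u v) (hA' : ∀ u v, GA.Adj u v → v ∈ A)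
    (hB : ∀ u v, H.Adj u v → u ∉ A → v ∉ A → GB.Adj u v) (hB' : ∀ u v, GB.Adj u v → v ∉ A) :
    ∃ g : (Σ d : {d : V × V // H.Adj d.1 d.2 ∧ d.1 ∈ A ∧ d.2 ∉ A},
        GA.Path a d.1.1 × GB.Path d.1.2 b) → H.Path a b,
      Function.Injective g ∧
        (∀ γ : H.Path a b, (γ.1.darts.countP fun d => decide (d.fst ∈ A ↔ d.snd ∉ A)) = 1 ↔
          γ ∈ Set.range g) ∧
        ∀ s, (g s).1.length = s.2.1.1.length + s.2.2.1.length + 1 := by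
  -- the pieces stay on their sides of the cut
  have hpA : ∀ {u : V} (p : GA.Walk a u),
      ∀ z ∈ (p.transfer H (edges_mem_of_le' hAle p)).support, z ∈ A := by
    intro u p
    rw [SimpleGraph.Walk.support_transfer]
    exact forall_mem_support_of_start (P := fun z => z ∈ A) hA' p ha
  have hqB : ∀ {v : V} (q : GB.Walk v b), v ∉ A →
      ∀ z ∈ (q.transfer H (edges_mem_of_le' hBle q)).support, z ∉ A := by
    intro v q hv
    rw [SimpleGraph.Walk.support_transfer]
    exact forall_mem_support_of_start (P := fun z => z ∉ A) hB' q hv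
  -- the glued walk is self-avoiding
  have hglue : ∀ s : (Σ d : {d : V × V // H.Adj d.1 d.2 ∧ d.1 ∈ A ∧ d.2 ∉ A},
      GA.Path a d.1.1 × GB.Path d.1.2 b),
      ((s.2.1.1.transfer H (edges_mem_of_le' hAle s.2.1.1)).append
        (SimpleGraph.Walk.cons s.1.2.1 (s.2.2.1.transfer H (edges_mem_of_le' hBle s.2.2.1)))).IsPath := by
    rintro ⟨⟨⟨u, v⟩, huv, hu, hv⟩, p, q⟩
    rw [SimpleGraph.Walk.isPath_def, SimpleGraph.Walk.support_append, SimpleGraph.Walk.support_cons,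
      List.tail_cons]
    refine List.nodup_append.2 ⟨?_, ?_, ?_⟩
    · rw [SimpleGraph.Walk.support_transfer]; exact p.2.support_nodup
    · rw [SimpleGraph.Walk.support_transfer]; exact q.2.support_nodup
    · intro z hz z' hz' hzz'
      exact hqB q.1 hv z' hz' (hzz' ▸ hpA p.1 z hz)
  refine ⟨fun s => ⟨_, hglue s⟩, ?_, ?_, ?_⟩
  · -- injective: `split_unique'`
    rintro ⟨⟨⟨u, v⟩, huv, hu, hv⟩, p, q⟩ ⟨⟨⟨u', v'⟩, huv', hu', hv'⟩, p', q'⟩ h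
    simp only [Subtype.mk.injEq] at h
    obtain ⟨hu₁, hv₁, hp, hq⟩ := split_unique' _ _ _ _ _ _ (hpA p.1) (hpA p'.1) hv hv' h
    subst hu₁ hv₁
    have hp' := congrArg SimpleGraph.Walk.edges (eq_of_heq hp)
    have hq' := congrArg SimpleGraph.Walk.edges (eq_of_heq hq)
    simp only [SimpleGraph.Walk.edges_transfer] at hp' hq'
    obtain rfl : p = p' := Subtype.ext (SimpleGraph.Walk.edges_injective hp')
    obtain rfl : q = q' := Subtype.ext (SimpleGraph.Walk.edges_injective hq')
    rfl
  · -- the range is the single-crossing sector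
    rintro ⟨w, hw⟩
    constructor
    · intro hcount
      obtain ⟨u, v, huv, p, q, hu, hv, rfl⟩ :=
        exists_split_of_countP_eq_one hAle hBle hA hB w ha hcount
      have hp : p.IsPath := by
        have h1 := hw.of_append_left
        rw [SimpleGraph.Walk.isPath_def, SimpleGraph.Walk.support_transfer] at h1
        exact (SimpleGraph.Walk.isPath_def p).2 h1
      have hq : q.IsPath := by
        have h1 := (hw.of_append_right).of_cons
        rw [SimpleGraph.Walk.isPath_def, SimpleGraph.Walk.support_transfer] at h1
        exact (SimpleGraph.Walk.isPath_def q).2 h1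
      exact ⟨⟨⟨(u, v), huv, hu, hv⟩, ⟨p, hp⟩, ⟨q, hq⟩⟩, rfl⟩
    · rintro ⟨⟨⟨⟨u, v⟩, huv, hu, hv⟩, p, q⟩, hs⟩
      rw [← hs]
      show ((SimpleGraph.Walk.append _ _).darts.countP _) = 1
      rw [SimpleGraph.Walk.darts_append, List.countP_append, countP_darts_cons,
        if_pos ⟨fun _ => hv, fun _ => hu⟩,
        countP_eq_zero_of_mem_iff A _ (fun z hz => iff_of_true (hpA p.1 z hz) ha),
        countP_eq_zero_of_mem_iff A _ (fun z hz => iff_of_false (hqB q.1 hv z hz) hv)]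
  · -- lengths
    rintro ⟨⟨⟨u, v⟩, huv, hu, hv⟩, p, q⟩
    simp only [SimpleGraph.Walk.length_append, SimpleGraph.Walk.length_cons,
      SimpleGraph.Walk.length_transfer]
    omega

/-! ## The sector decomposition -/

open Classical in
/-- **Sector decomposition of the single-crossing kernel.** For a vertex set `A`, `a ∈ A`, any `b` and
`0 ≤ x`, the kernel of `H` restricted to the self-avoiding paths `a → b` with exactly one dart across
the cut `(A, Aᶜ)` is `x · Σ_{(u,v)} Z_A(a,u) · Z_{Aᶜ}(v,b)`, the sum over the cut darts `u → v` of `H`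
(`u ∈ A`, `v ∉ A`), `Z_A`, `Z_{Aᶜ}` being the path kernels of the parts
`SimpleGraph.fromRel (H.Adj a b ∧ a ∈ A ∧ b ∈ A)`, `SimpleGraph.fromRel (H.Adj a b ∧ a ∉ A ∧ b ∉ A)`
of `H`: such a path splits uniquely at its crossing dart (`exists_singleCrossing_glue`; for `b ∈ A`
both sides vanish). [folklore] -/
theorem pathKernelOn_singleCrossing_eq (H : SimpleGraph V) (x : ℝ) (hx : 0 ≤ x) (A : Set V)
    (a b : V) (ha : a ∈ A) :
    pathKernelOn H x a b {γ | (γ.1.darts.countP fun d => decide (d.fst ∈ A ↔ d.snd ∉ A)) = 1} =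
      ENNReal.ofReal x * ∑' d : {d : V × V // H.Adj d.1 d.2 ∧ d.1 ∈ A ∧ d.2 ∉ A},
        pathKernel (SimpleGraph.fromRel fun a b => H.Adj a b ∧ a ∈ A ∧ b ∈ A) x a d.1.1 *
          pathKernel (SimpleGraph.fromRel fun a b => H.Adj a b ∧ a ∉ A ∧ b ∉ A) x d.1.2 b := by
  obtain ⟨g, hg, hrange, hlen⟩ := exists_singleCrossing_glue (A := A) (b := b)
    (GA := SimpleGraph.fromRel fun a b => H.Adj a b ∧ a ∈ A ∧ b ∈ A)
    (GB := SimpleGraph.fromRel fun a b => H.Adj a b ∧ a ∉ A ∧ b ∉ A) ha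
    (fun u v h => ((fromRel_part_adj H (· ∈ A)).1 h).1)
    (fun u v h => ((fromRel_part_adj H (· ∉ A)).1 h).1)
    (fun u v h hu hv => (fromRel_part_adj H (· ∈ A)).2 ⟨h, hu, hv⟩)
    (fun u v h => ((fromRel_part_adj H (· ∈ A)).1 h).2.2)
    (fun u v h hu hv => (fromRel_part_adj H (· ∉ A)).2 ⟨h, hu, hv⟩)
    (fun u v h => ((fromRel_part_adj H (· ∉ A)).1 h).2.2)
  set S : Set (H.Path a b) :=
    {γ | (γ.1.darts.countP fun d => decide (d.fst ∈ A ↔ d.snd ∉ A)) = 1}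
  have hsub : Function.support (S.indicator fun γ : H.Path a b => ENNReal.ofReal (x ^ γ.1.length)) ⊆
      Set.range g :=
    fun γ hγ => (hrange γ).1 (Set.support_indicator_subset (s := S) hγ)
  have hterm : ∀ s, S.indicator (fun γ : H.Path a b => ENNReal.ofReal (x ^ γ.1.length)) (g s) =
      ENNReal.ofReal x *
        (ENNReal.ofReal (x ^ s.2.1.1.length) * ENNReal.ofReal (x ^ s.2.2.1.length)) := by
    intro s
    rw [Set.indicator_of_mem (show g s ∈ S from (hrange (g s)).2 ⟨s, rfl⟩), hlen s, pow_succ,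
      ENNReal.ofReal_mul' hx, pow_add, ENNReal.ofReal_mul (pow_nonneg hx _)]
    ring
  unfold pathKernelOn
  rw [← hg.tsum_eq hsub, tsum_congr hterm, ENNReal.tsum_mul_left, ENNReal.tsum_sigma']
  congr 1
  refine tsum_congr fun d => ?_
  rw [ENNReal.tsum_prod', pathKernel, pathKernel, ← ENNReal.tsum_mul_right]
  refine tsum_congr fun p => ?_
  rw [← ENNReal.tsum_mul_left]

end Summit.CriticalPhenomena.SAWScalingLimit.Theorems.BoundaryTP2

end
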